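import Literature.NumberTheory.LFunctions.KMVDiagonalSlack

/-!
LANDING NOTE (typer ls-idea-typ-1 gen 1, cell ls-idea): card K5-8 ★ «CHECK ζ′ RUN ⇒ (A)-PLATEAU LAW»
(seat ls-idea-lens-5 gen 3, `cards/ls-idea-lens-5.md` § gen 3; critic A PASS ★ LAW AT RECIPE GRADE,
batch 23, algebra independently re-checked by A; B/C pending at typing time). Typed in the `KMV2000`
namespace as (i) a DEFINITION of the card's closed-form exceptional-branch second table
`T₂^{(A)}(Δ, P; c₀) = Δ⁻¹ ∫₀^{r} P″(u) P″(r − u) du`, `r = 2(1 − c₀/Δ)` (recipe-level DERIVATION of the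
card under its MODEL «strong (A) = lacunarity», NOT a theorem and NOT asserted to be the true table —
a candidate `R` for the tree's `MomentAsymptoticsTwoBranch`), (ii) PROVED elementary identities (the
`P = X²` evaluation `8(Δ − c₀)/Δ²`, its value `Δ²/(2(Δ² + 3Δ − 2c₀))` and sub-¼ window, the
complementarity `2·envelope c₀ + 2·envelope c₀⁻¹ = 1`), and (iii) the card's PLATEAU LAW (a pure
real-analysis variational statement about this functional) as a PROP SHAPE, provable but not proved
here. «The programme SEARCHES and TYPES; no claim about Landau–Siegel zeros, Theorems 1–2 of
arXiv:2211.02515 or a repaired Margin232 until a kernel theorem says so.»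

## References
* [KowalskiMichelVanderKam2000] J. reine angew. Math. 526 (2000), Thm. 6.1 (31)–(32), §6 p. 19 (the
  two-term main-term forms `linForm`, `secondMomentForm`; tree). [held: paper:doi-10-1515-crll-2000-074]
* [BuiPrattZaharescu2023] H. M. Bui, K. Pratt, A. Zaharescu, J. London Math. Soc. 109 (2024) =
  arXiv:2102.03087, §1 p. 3 L44–L49 («there seems to be a barrier to going past 50%»).
  [held: paper:doi-10-1112-jlms-12834 p0003]

# The exceptional-branch PLATEAU of the one-piece mollified second moment (card K5-8 ★, recipe level)

MODEL of the card (conditional throughout): strong (A) = lacunarity of `χ_D` up to `q^C`, compatible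
prime level `q`, `d = log D/log q`, `c₀ = 1 + 2d`. The card RUNS the CFKRS recipe for the mollified
second moment on the exceptional branch and finds, in the door's units (two-term part = the tree's
`secondMomentForm Δ P 1 = P′(1)² + Δ⁻¹∫₀¹ P″²`): `T₁^{(A)} = 0` and
`T₂^{(A)}(Δ, P; d) = Δ⁻¹ ∫₀^{r} P″(u) P″(r−u) du · 𝟙[r > 0]`, `r = 2(1 − c₀/Δ)` — the exceptional branch
ADDS the self-convolution of `P″` over the log-excess window, alive iff `Δ > c₀` (⟺ `Y > D²`). PLATEAU
LAW (card, exact variational solution over `g = P″ ∈ L²`): for `Δ ∈ (0, 2c₀]`,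
`sup_P value(Δ, P) = envelope(min(Δ, c₀))`, i.e. `Δ_eff = min(Δ, 1+2d)`; complementarity with the
twisted family gives `p₁^{sup} + p₂^{sup} = 1` exactly, switch-on points `Δ₁*Δ₂* = 1` (= the tree's
`pincer_sum_gt_one_iff` boundary). This file: the functional (definition), the `X²` identities and the
complementarity arithmetic (proved), the plateau law (Prop shape). Nothing about L-functions asserted.
-/

noncomputable section

open Polynomial intervalIntegral MeasureTheory Set

namespace Literature.NumberTheory.LFunctions.KMV2000

/-- K5-8's log-excess window `r(Δ; c₀) := 2(1 − c₀/Δ)` (`∈ (0, 1]` on `Δ ∈ (c₀, 2c₀]`; `c₀ = 1 + 2d`).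
A DEFINITION. [cite: KowalskiMichelVanderKam2000, §6 p. 19 (Δ = 2 log M/log q)] -/
def plateauWindow (c₀ Δ : ℝ) : ℝ := 2 * (1 - c₀ / Δ)

/-- **K5-8's exceptional-branch second table** (the card's recipe-level closed form, in the door's
units): `T₂^{(A)}(Δ, P; c₀) := Δ⁻¹ ∫₀^{r} P″(u)·P″(r − u) du` if `r = plateauWindow c₀ Δ > 0`, else `0`
(the self-convolution `(P″ ∗ P″)(r)`; `T₁^{(A)} = 0`). A DEFINITION of a functional on profiles — a
CANDIDATE exceptional functional `R Δ P 1` for `MomentAsymptoticsTwoBranch` under the card's MODEL, NOT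
asserted to be the true table. [cite: KowalskiMichelVanderKam2000, Thm. 6.1 (32) (the two-term part it corrects)] -/
def excSecondTable (c₀ Δ : ℝ) (P : ℝ[X]) : ℝ :=
  if 0 < plateauWindow c₀ Δ then
    Δ⁻¹ * ∫ u in (0 : ℝ)..plateauWindow c₀ Δ,
      (derivative (derivative P)).eval u * (derivative (derivative P)).eval (plateauWindow c₀ Δ - u)
  else 0

/-- Below the switch-on point (`Δ ≤ c₀`, i.e. `Y ≤ D²`) the exceptional table VANISHES (the card:
«alive iff `Δ > c₀`»; proved from the definition, for `0 < Δ`). [cite: KowalskiMichelVanderKam2000, Thm. 6.1 (32)] -/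
theorem excSecondTable_of_le {c₀ Δ : ℝ} (hΔ : 0 < Δ) (h : Δ ≤ c₀) (P : ℝ[X]) :
    excSecondTable c₀ Δ P = 0 := by
  unfold excSecondTable plateauWindow
  have : ¬ 0 < 2 * (1 - c₀ / Δ) := by
    have h1 : 1 ≤ c₀ / Δ := by rw [le_div_iff₀ hΔ]; linarith
    linarith
  rw [if_neg this]

/-- **K5-8, the `P = X²` evaluation (proved):** for `0 < c₀ < Δ`,
`T₂^{(A)}(Δ, X²; c₀) = 8(Δ − c₀)/Δ²` (`P″ ≡ 2`, `∫₀^r 4 = 4r`). A's independent check ✓.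
[cite: KowalskiMichelVanderKam2000, Thm. 6.1 (32)] -/
theorem excSecondTable_X_sq {c₀ Δ : ℝ} (hΔ : 0 < Δ) (h : c₀ < Δ) :
    excSecondTable c₀ Δ (X ^ 2) = 8 * (Δ - c₀) / Δ ^ 2 := by
  unfold excSecondTable plateauWindow
  have hr : 0 < 2 * (1 - c₀ / Δ) := by
    have h1 : c₀ / Δ < 1 := by rw [div_lt_one hΔ]; exact h
    linarith
  rw [if_pos hr]
  have hdd : derivative (derivative (X ^ 2 : ℝ[X])) = C 2 := by
    rw [derivative_X_sq, derivative_C_mul, derivative_X, mul_one]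
  rw [hdd]
  simp only [eval_C]
  rw [intervalIntegral.integral_const, smul_eq_mul]
  field_simp
  ring

/-- **K5-8, the value of `P = X²` on the exceptional branch (proved arithmetic):** with
`lin = 2`, `second = 4 + 4/Δ` and `T₂ = 8(Δ − c₀)/Δ²`,
`valueWith Δ X² 1 0 T₂ = Δ²/(2(Δ² + 3Δ − 2c₀))` (for `0 < c₀ < Δ`). [cite: KowalskiMichelVanderKam2000, Thm. 6.1 (31)–(32)] -/
theorem valueWith_X_sq_excBranch {c₀ Δ : ℝ} (hΔ : 0 < Δ) (hc : 0 < c₀) (h : c₀ < Δ) :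
    valueWith Δ (X ^ 2) 1 0 (excSecondTable c₀ Δ (X ^ 2)) = Δ ^ 2 / (2 * (Δ ^ 2 + 3 * Δ - 2 * c₀)) := by
  rw [valueWith, excSecondTable_X_sq hΔ h, linForm_X_sq_one, secondMomentForm_X_sq_one, add_zero]
  have hden : 0 < Δ ^ 2 + 3 * Δ - 2 * c₀ := by nlinarith
  have hΔ0 : Δ ≠ 0 := hΔ.ne'
  have e : 4 + 4 / Δ + 8 * (Δ - c₀) / Δ ^ 2 = 4 * (Δ ^ 2 + 3 * Δ - 2 * c₀) / Δ ^ 2 := by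
    field_simp
    ring
  rw [e, div_eq_div_iff (by positivity) (by positivity)]
  field_simp
  ring

/-- **K5-8, the sub-¼ window of `P = X²` (proved):** on the exceptional branch the `X²`-value is
`< ¼` exactly when `Δ² − 3Δ + 2c₀ < 0`, i.e. `Δ ∈ ((3 − √(9−8c₀))/2, (3 + √(9−8c₀))/2)` (K = 40:
`(1.113, 1.887)`; no window for `K < 16`) — «an engine run with `P = t²` alone reports T₂ > diagSlack on
most of (1,2) and that is an artefact of P, not of the branch». [cite: KowalskiMichelVanderKam2000, Thm. 6.1 (31)–(32)] -/
theorem valueWith_X_sq_excBranch_lt_quarter_iff {c₀ Δ : ℝ} (hΔ : 0 < Δ) (hc : 0 < c₀) (h : c₀ < Δ) :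
    valueWith Δ (X ^ 2) 1 0 (excSecondTable c₀ Δ (X ^ 2)) < 1 / 4 ↔ Δ ^ 2 - 3 * Δ + 2 * c₀ < 0 := by
  rw [valueWith_X_sq_excBranch hΔ hc h]
  have hden : 0 < 2 * (Δ ^ 2 + 3 * Δ - 2 * c₀) := by nlinarith
  rw [div_lt_iff₀ hden]
  constructor <;> intro hh <;> nlinarith

/-- **K5-8 COMPLEMENTARITY (proved arithmetic):** the two plateau proportions
`p₁^{sup} = 2·envelope c₀ = c₀/(1+c₀)` (untwisted, `Δ_eff = c₀`) and
`p₂^{sup} = 2·envelope c₀⁻¹ = 1/(1+c₀)` (twisted) sum to EXACTLY `1` — the boundary case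
`Δ₁*·Δ₂* = c₀·c₀⁻¹ = 1` of the conservation law `pincer_sum_gt_one_iff` (world (A) ties IS's purity
cap with zero slack at recipe level). [cite: KowalskiMichelVanderKam2000, Thm. 6.1 (32)] -/
theorem two_envelope_add_two_envelope_inv {c₀ : ℝ} (hc : 0 < c₀) :
    2 * envelope c₀ + 2 * envelope c₀⁻¹ = 1 := by
  unfold envelope
  field_simp
  ring

/-- With the PRINTED twisted input `p₂ = ½ − d` instead of the twisted plateau, the untwisted plateau
`p₁^{sup} = c₀/(1+c₀)`, `c₀ = 1 + 2d`, leaves the margin `p₁^{sup} + p₂ − 1 = −d(1+2d)/(2(1+d)) < 0`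
(NO FORCE for any `Δ ≤ 2c₀` and any profile, card verdict (2)). Proved arithmetic (`−1 < d`).
[cite: KowalskiMichelVanderKam2000, Thm. 6.1 (32)] -/
theorem plateau_margin_printed_twisted (d : ℝ) (hd : -1 < d) :
    2 * envelope (1 + 2 * d) + (1 / 2 - d) - 1 = -(d * (1 + 2 * d)) / (2 * (1 + d)) := by
  unfold envelope
  have h1 : (1 : ℝ) + (1 + 2 * d) = 2 * (1 + d) := by ring
  have h2 : (1 : ℝ) + d ≠ 0 := by intro h; linarith
  rw [h1, eq_div_iff (by positivity)]
  field_simp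
  ring

/-- **K5-8 PLATEAU LAW (shape; the card's exact variational solution, NOT proved here).** For
`0 < c₀ ≤ Δ ≤ 2c₀` and every admissible profile `P`, the exceptional-branch value is at most the
plateau: `lin² ≤ 2·envelope(c₀)·(second + T₂^{(A)})`, i.e. `value ≤ c₀/(2(1+c₀))` INDEPENDENTLY of `Δ`
(«on the exceptional branch mollifying past `Y = D²` buys NOTHING»; `Δ_eff = min(Δ, 1+2d)`). Proof
sketch (card): `g = P″`, `second^{(A)} = (∫g)² + Δ⁻¹⟨g, (I + S_r)g⟩` with `S_r` the reflection of
`[0,r]` about `r/2` (self-adjoint involution; odd part = zero mode), Cauchy–Schwarz gives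
`⟨g,(I+S_r)g⟩ ≥ 2(∫g)²/(2 − r) = (Δ/c₀)(∫g)²`. Below `c₀` the table vanishes and the bound is the
tree's `ratio_one_le` at `envelope Δ ≤ envelope c₀`. A PREDICATE in `c₀`; pure real analysis, typer may
discharge. [cite: KowalskiMichelVanderKam2000, Thm. 6.1 (32) and §7 p. 21 (optimal profile)] -/
def PlateauLaw (c₀ : ℝ) : Prop :=
  ∀ Δ : ℝ, c₀ ≤ Δ → Δ ≤ 2 * c₀ → ∀ P : ℝ[X], Admissible P →
    linForm Δ P 1 ^ 2 ≤ 2 * envelope c₀ * (secondMomentForm Δ P 1 + excSecondTable c₀ Δ P)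

end Literature.NumberTheory.LFunctions.KMV2000
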